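import Mathlib
import HarnessLib
import Literature.MathematicalPhysics.QuantumLattice.SectorisedKernelNormExtraction
import Summits.HubbardSuperconductivity.HubbardSuperconductivity.Theorems.KLProgrammeKLRegimeEngineIsoResectorisation

/-!
# Route `KLProgramme` — ENGINE item stmt-HubbardSuperconductivity-20437, class #6 / (E5-F)ₙ producer, route (M): the TRANSFER IDENTITY for sectorised kernels —
# a fine-family kernel from the coarse-family kernels by leg-wise convolution with `Θ = E(F′)·S(1)`, and the pinned-`L¹` (fixed-tuple) transport bound (generic)

Cell gate-hubbard-kl, seat hubbard-kl-k3c2-p2 (g12; owner-designate of M1 + M3 of route (M), pen (R59az)).  Re-sectorising an `F`-sectorised kernel in a finer family `F′`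
living in the plateau `{Σ_w F_w = 1}` is, leg by leg, a position-space convolution with the transfer kernel `Θ = E(F′)·S(1)` of the FINE family alone (Fourier inversion
`sum_sectorisedKernel_mul_conj_prod`; no fat partner is needed because the coarse multipliers are carried by the coarse sectorised kernels themselves); the terms whose
coarse sector string does not overlap the fine one leg by leg vanish; so the pinned `L¹` size of a fine tuple is at most `#parents × (column/row sums of Θ)^{legs} ×` the
pinned sizes of its parents (any polynomial `G`, any pair of families):

* `sectorisedKernel_eq_sum_coarse` (partition of unity under the fine supports), `coarseTerm_eq_zero_of_leg`,
  **`coarseTerm_eq_transfer_sum`** (the convolution identity `term_σ(x) = ε^m Σ_y (∏_i Θ_i(x_i,y_i))·W_{F,σ}(y)`), `sum_prod_norm_vecCons_le`, and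
  **`fixedTupleL1_le_of_plateau_transfer`**: `fixedTupleL1 β m W_{F′} Ω′ x₁ ≤ #Par · C_τ^{m+1} · S` from column/row sums `≤ C_τ/ε` of `Θ` and pinned sizes `≤ S` of the parents.

The iso ← iso instance under the stub binders and the M3 assembly with moments at the kernel's own resolution are in `…EngineIsoLineTransport`.  Everything is proved; no
definitions; nothing about the model is asserted.  References: BGM 2006 §2.7 (2.70)–(2.71a), §2.8 (2.82) [cite: BenfattoGiulianiMastropietro2006].
-/

noncomputable section

namespace Summit.HubbardSuperconductivity.HubbardSuperconductivity.Theorems.EngineV8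

set_option linter.dupNamespace false -- summit = problem name (single-conjunct summit), D-0017

open Classical
open Real Finset Complex Literature.MathematicalPhysics.QuantumLattice Literature.Probability.LatticeModels GrassmannAlgebra
open Summit.HubbardSuperconductivity.HubbardSuperconductivity.Theorems.KLProgrammeLegKernels
open Summit.HubbardSuperconductivity.HubbardSuperconductivity.Theorems.KLRegimeSplit
open Summit.HubbardSuperconductivity.HubbardSuperconductivity.Theorems.TorusFourierL2
open Summit.HubbardSuperconductivity.HubbardSuperconductivity.Theorems.PerturbedFermiCurve (support_klIsoFamily card_coarse_overlap_le)
open scoped ComplexConjugate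

variable {L M : ℕ} [NeZero L] [NeZero M]

/-! ## §1 Generic: fine kernels from coarse kernels by the transfer kernel of the fine family -/

section Generic

variable {N N' : ℕ}

omit [NeZero M] in
/-- **Partition of unity under the fine supports**: if `Σ_w F_w = 1` wherever a fine multiplier `F′_{ω′_i}` of the tuple is nonzero, then
`W_{F′,Ω′}(x) = Σ_σ Σ_k (∏_i F′_{ω′_i}(k_i)·F_{σ_i}(k_i)·e_i) · K(k)` (sum over coarse sector strings `σ`). -/
theorem sectorisedKernel_eq_sum_coarse (β : ℝ) (F' : Fin N' → FreqMomentum L M → ℂ) (F : Fin N → FreqMomentum L M → ℂ) (G : HubbardGrassmann L M)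
    {m : ℕ} (Ω' : Fin m → SectorLeg N') (hpl : ∀ i k, F' (Ω' i).1.1 k ≠ 0 → ∑ w, F w k = 1) (x : Fin m → SpaceTimeIdx L M) :
    sectorisedKernel L M β F' G m Ω' x =
      ∑ σ : Fin m → Fin N, ∑ k : Fin m → FreqMomentum L M,
        (∏ i, F' (Ω' i).1.1 (k i) * F (σ i) (k i) * hubbardPlaneWave L M β (Ω' i).2 (k i) (x i)) *
          kernel ℂ G m (fun i => ((k i, (Ω' i).1.2), (Ω' i).2)) := by
  rw [sectorisedKernel_def, sum_comm]
  refine sum_congr rfl fun k _ => ?_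
  rw [← sum_mul]
  congr 1
  have h1 : ∀ i, F' (Ω' i).1.1 (k i) * hubbardPlaneWave L M β (Ω' i).2 (k i) (x i) =
      ∑ w, F' (Ω' i).1.1 (k i) * F w (k i) * hubbardPlaneWave L M β (Ω' i).2 (k i) (x i) := by
    intro i
    by_cases h0 : F' (Ω' i).1.1 (k i) = 0
    · simp [h0]
    · simp_rw [mul_assoc, ← mul_sum, ← sum_mul, hpl i (k i) h0, one_mul]
  simp_rw [h1]
  exact Fintype.prod_sum (fun i w => F' (Ω' i).1.1 (k i) * F w (k i) * hubbardPlaneWave L M β (Ω' i).2 (k i) (x i))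

omit [NeZero M] in
/-- A coarse string that misses the fine tuple on some leg contributes nothing. -/
theorem coarseTerm_eq_zero_of_leg (β : ℝ) (F' : Fin N' → FreqMomentum L M → ℂ) (F : Fin N → FreqMomentum L M → ℂ) (G : HubbardGrassmann L M)
    {m : ℕ} (Ω' : Fin m → SectorLeg N') (σ : Fin m → Fin N) (h : ∃ i, ∀ k, F' (Ω' i).1.1 k * F (σ i) k = 0) (x : Fin m → SpaceTimeIdx L M) :
    ∑ k : Fin m → FreqMomentum L M,
        (∏ i, F' (Ω' i).1.1 (k i) * F (σ i) (k i) * hubbardPlaneWave L M β (Ω' i).2 (k i) (x i)) *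
          kernel ℂ G m (fun i => ((k i, (Ω' i).1.2), (Ω' i).2)) = 0 := by
  obtain ⟨i, hi⟩ := h
  refine sum_eq_zero fun k _ => ?_
  rw [prod_eq_zero (mem_univ i) (by rw [hi, zero_mul]), zero_mul]

/-- **THE CONVOLUTION IDENTITY** (`β ≠ 0`): the coarse-string term is the leg-wise transform of the coarse sectorised kernel by the transfer kernel
`Θ = E(F′)·S(1)` of the FINE family: `term_σ(x) = ε^m · Σ_y (∏_i Θ((x_i, Ω′_i), (y_i, ((0, s_i), c_i)))) · W_{F,(σ,s,c)}(y)`. -/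
theorem coarseTerm_eq_transfer_sum {β : ℝ} (hβ : β ≠ 0) (F' : Fin N' → FreqMomentum L M → ℂ) (F : Fin N → FreqMomentum L M → ℂ)
    (G : HubbardGrassmann L M) {m : ℕ} (Ω' : Fin m → SectorLeg N') (σ : Fin m → Fin N) (x : Fin m → SpaceTimeIdx L M) :
    ∑ k : Fin m → FreqMomentum L M,
        (∏ i, F' (Ω' i).1.1 (k i) * F (σ i) (k i) * hubbardPlaneWave L M β (Ω' i).2 (k i) (x i)) *
          kernel ℂ G m (fun i => ((k i, (Ω' i).1.2), (Ω' i).2)) =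
      ((imagTimeWeight β M : ℝ) : ℂ) ^ m * ∑ y : Fin m → SpaceTimeIdx L M,
        (∏ i, (sectorAnalysisMatrix L M β F' * sectorSubMatrix L M β (trivialMultiplier L M))
            (x i, Ω' i) (y i, (((0 : Fin 1), (Ω' i).1.2), (Ω' i).2))) *
          sectorisedKernel L M β F G m (fun i => ((σ i, (Ω' i).1.2), (Ω' i).2)) y := by
  set P : ℂ := (Fintype.card (SpaceTimeIdx L M) : ℂ) with hP
  set cβ : ℂ := (((1 / (β * (L : ℝ) ^ 2) : ℝ)) : ℂ) with hcβ
  -- the transfer entries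
  have hΘ : ∀ (i : Fin m) (xi yi : SpaceTimeIdx L M),
      (sectorAnalysisMatrix L M β F' * sectorSubMatrix L M β (trivialMultiplier L M)) (xi, Ω' i) (yi, (((0 : Fin 1), (Ω' i).1.2), (Ω' i).2)) =
        ∑ q : FreqMomentum L M, (F' (Ω' i).1.1 q * hubbardPlaneWave L M β (Ω' i).2 q xi * cβ) * conj (hubbardPlaneWave L M β (Ω' i).2 q yi) := by
    intro i xi yi
    rw [sectorAnalysis_mul_sectorSub_apply, if_pos ⟨rfl, rfl⟩]
    refine sum_congr rfl fun q _ => ?_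
    simp only [trivialMultiplier, one_mul]
    ring
  -- expand the product of the entries over the legs
  have hprod : ∀ y : Fin m → SpaceTimeIdx L M,
      (∏ i, (sectorAnalysisMatrix L M β F' * sectorSubMatrix L M β (trivialMultiplier L M))
          (x i, Ω' i) (y i, (((0 : Fin 1), (Ω' i).1.2), (Ω' i).2))) =
        ∑ q : Fin m → FreqMomentum L M, (∏ i, F' (Ω' i).1.1 (q i) * hubbardPlaneWave L M β (Ω' i).2 (q i) (x i) * cβ) *
          conj (∏ i, hubbardPlaneWave L M β (Ω' i).2 (q i) (y i)) := by
    intro y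
    simp_rw [hΘ]
    rw [Fintype.prod_sum (fun i q => (F' (Ω' i).1.1 q * hubbardPlaneWave L M β (Ω' i).2 q (x i) * cβ) * conj (hubbardPlaneWave L M β (Ω' i).2 q (y i)))]
    refine sum_congr rfl fun q _ => ?_
    rw [map_prod, ← prod_mul_distrib]
  simp_rw [hprod, sum_mul]
  rw [sum_comm]
  -- for each `q`, Fourier inversion of the coarse kernel
  have hinv : ∀ q : Fin m → FreqMomentum L M,
      ∑ y : Fin m → SpaceTimeIdx L M, (∏ i, F' (Ω' i).1.1 (q i) * hubbardPlaneWave L M β (Ω' i).2 (q i) (x i) * cβ) *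
          conj (∏ i, hubbardPlaneWave L M β (Ω' i).2 (q i) (y i)) *
          sectorisedKernel L M β F G m (fun i => ((σ i, (Ω' i).1.2), (Ω' i).2)) y =
        (∏ i, F' (Ω' i).1.1 (q i) * hubbardPlaneWave L M β (Ω' i).2 (q i) (x i) * cβ) *
          (P ^ m * (∏ i, F (σ i) (q i)) * kernel ℂ G m (fun i => ((q i, (Ω' i).1.2), (Ω' i).2))) := by
    intro q
    have h := sum_sectorisedKernel_mul_conj_prod hβ F G m (fun i => ((σ i, (Ω' i).1.2), (Ω' i).2)) q
    simp only at h
    rw [← h, mul_sum]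
    refine sum_congr rfl fun y _ => ?_
    ring
  simp_rw [hinv]
  rw [mul_sum]
  refine sum_congr rfl fun q _ => ?_
  -- collect: `(ε · P · cβ)^m = 1`
  have hεP : ((imagTimeWeight β M : ℝ) : ℂ) * P * cβ = 1 := by
    have h1 : imagTimeWeight β M * (Fintype.card (SpaceTimeIdx L M) : ℝ) = β * (L : ℝ) ^ 2 := imagTimeWeight_mul_card β L M
    have hL : (L : ℝ) ≠ 0 := by exact_mod_cast NeZero.ne L
    have hβL : β * (L : ℝ) ^ 2 ≠ 0 := mul_ne_zero hβ (pow_ne_zero 2 hL)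
    rw [hP, hcβ, ← Complex.ofReal_natCast, ← Complex.ofReal_mul, h1, ← Complex.ofReal_mul, one_div, mul_inv_cancel₀ hβL, Complex.ofReal_one]
  have hsplit : (∏ i, F' (Ω' i).1.1 (q i) * hubbardPlaneWave L M β (Ω' i).2 (q i) (x i) * cβ) =
      (∏ i, F' (Ω' i).1.1 (q i) * hubbardPlaneWave L M β (Ω' i).2 (q i) (x i)) * cβ ^ m := by
    rw [prod_mul_distrib, prod_const, card_univ, Fintype.card_fin]
  have hsplit2 : (∏ i, F' (Ω' i).1.1 (q i) * F (σ i) (q i) * hubbardPlaneWave L M β (Ω' i).2 (q i) (x i)) =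
      (∏ i, F' (Ω' i).1.1 (q i) * hubbardPlaneWave L M β (Ω' i).2 (q i) (x i)) * ∏ i, F (σ i) (q i) := by
    rw [← prod_mul_distrib]
    exact prod_congr rfl fun i _ => by ring
  rw [hsplit, hsplit2]
  have hone : ((imagTimeWeight β M : ℝ) : ℂ) ^ m * (cβ ^ m * P ^ m) = 1 := by
    rw [← mul_pow, ← mul_pow, show ((imagTimeWeight β M : ℝ) : ℂ) * (cβ * P) = ((imagTimeWeight β M : ℝ) : ℂ) * P * cβ by ring, hεP, one_pow]
  calc (∏ i, F' (Ω' i).1.1 (q i) * hubbardPlaneWave L M β (Ω' i).2 (q i) (x i)) * (∏ i, F (σ i) (q i)) *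
        kernel ℂ G m (fun i => ((q i, (Ω' i).1.2), (Ω' i).2))
      = (((imagTimeWeight β M : ℝ) : ℂ) ^ m * (cβ ^ m * P ^ m)) *
          ((∏ i, F' (Ω' i).1.1 (q i) * hubbardPlaneWave L M β (Ω' i).2 (q i) (x i)) * (∏ i, F (σ i) (q i)) *
            kernel ℂ G m (fun i => ((q i, (Ω' i).1.2), (Ω' i).2))) := by rw [hone, one_mul]
    _ = _ := by ring

omit [NeZero M] in
/-- **Pinned sums of a product of transfer factors**: with column sums `Σ_x ‖Θ_i(x, y)‖ ≤ C` on the free legs,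
`Σ_{x′} ∏_i ‖Θ_i((x₁::x′)_i, y_i)‖ ≤ ‖Θ_0(x₁, y_0)‖ · C^m`. -/
theorem sum_prod_norm_vecCons_le {m : ℕ} (Θ : Fin (m + 1) → SpaceTimeIdx L M → SpaceTimeIdx L M → ℂ) {C : ℝ}
    (hcol : ∀ (j : Fin m) (y : SpaceTimeIdx L M), ∑ x, ‖Θ j.succ x y‖ ≤ C) (x₁ : SpaceTimeIdx L M) (y : Fin (m + 1) → SpaceTimeIdx L M) :
    ∑ x' : Fin m → SpaceTimeIdx L M, ∏ i, ‖Θ i (Matrix.vecCons x₁ x' i) (y i)‖ ≤ ‖Θ 0 x₁ (y 0)‖ * C ^ m := by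
  have h1 : ∀ x' : Fin m → SpaceTimeIdx L M, (∏ i, ‖Θ i (Matrix.vecCons x₁ x' i) (y i)‖) =
      ‖Θ 0 x₁ (y 0)‖ * ∏ j : Fin m, ‖Θ j.succ (x' j) (y j.succ)‖ := by
    intro x'
    rw [Fin.prod_univ_succ]
    simp only [Matrix.cons_val_zero, Matrix.cons_val_succ]
  simp_rw [h1]
  have hfac : ∑ x' : Fin m → SpaceTimeIdx L M, ∏ j : Fin m, ‖Θ j.succ (x' j) (y j.succ)‖ =
      ∏ j : Fin m, ∑ z : SpaceTimeIdx L M, ‖Θ j.succ z (y j.succ)‖ := by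
    rw [Finset.prod_univ_sum, Fintype.piFinset_univ]
  rw [← mul_sum, hfac]
  refine mul_le_mul_of_nonneg_left ?_ (norm_nonneg _)
  calc ∏ j : Fin m, ∑ z, ‖Θ j.succ z (y j.succ)‖ ≤ ∏ _j : Fin m, C :=
        prod_le_prod (fun j _ => sum_nonneg fun z _ => norm_nonneg _) fun j _ => hcol j (y j.succ)
    _ = C ^ m := by rw [prod_const, card_univ, Fintype.card_fin]

/-- **L¹ TRANSPORT ACROSS A PLATEAU** (`0 < β`; any polynomial `G`; fine family `F′` in the plateau of the coarse family `F` under the fine tuple `Ω′`): if the transfer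
kernel `Θ = E(F′)·S(1)` has column and row sums `≤ C_τ/ε` on the legs of `Ω′`, if every coarse string outside `Par` misses `Ω′` on some leg, and if every parent
`σ ∈ Par` (with the spins/charges of `Ω′`) has pinned size `fixedTupleL1 β m W_F (σ,s,c) y₀ ≤ S` at every pin, then
`fixedTupleL1 β m W_{F′} Ω′ x₁ ≤ #Par · C_τ^{m+1} · S`. -/
theorem fixedTupleL1_le_of_plateau_transfer {β : ℝ} (hβ : 0 < β) (F' : Fin N' → FreqMomentum L M → ℂ) (F : Fin N → FreqMomentum L M → ℂ)
    (G : HubbardGrassmann L M) {m : ℕ} (Ω' : Fin (m + 1) → SectorLeg N') (hpl : ∀ i k, F' (Ω' i).1.1 k ≠ 0 → ∑ w, F w k = 1)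
    (Par : Finset (Fin (m + 1) → Fin N)) (hPar : ∀ σ, σ ∉ Par → ∃ i, ∀ k, F' (Ω' i).1.1 k * F (σ i) k = 0)
    {Cτ S : ℝ} (hC0 : 0 ≤ Cτ) (hS0 : 0 ≤ S)
    (hcol : ∀ (i : Fin (m + 1)) (y : SpaceTimeIdx L M), ∑ x : SpaceTimeIdx L M,
      ‖(sectorAnalysisMatrix L M β F' * sectorSubMatrix L M β (trivialMultiplier L M)) (x, Ω' i) (y, (((0 : Fin 1), (Ω' i).1.2), (Ω' i).2))‖ ≤
        Cτ / imagTimeWeight β M)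
    (hrow : ∀ x : SpaceTimeIdx L M, ∑ y : SpaceTimeIdx L M,
      ‖(sectorAnalysisMatrix L M β F' * sectorSubMatrix L M β (trivialMultiplier L M)) (x, Ω' 0) (y, (((0 : Fin 1), (Ω' 0).1.2), (Ω' 0).2))‖ ≤
        Cτ / imagTimeWeight β M)
    (hS : ∀ σ ∈ Par, ∀ y₀ : SpaceTimeIdx L M,
      fixedTupleL1 L M β m (sectorisedKernel L M β F G (m + 1)) (fun i => ((σ i, (Ω' i).1.2), (Ω' i).2)) y₀ ≤ S)
    (x₁ : SpaceTimeIdx L M) :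
    fixedTupleL1 L M β m (sectorisedKernel L M β F' G (m + 1)) Ω' x₁ ≤ Par.card * Cτ ^ (m + 1) * S := by
  have hMr : (0 : ℝ) < M := Nat.cast_pos.2 (Nat.pos_of_ne_zero (NeZero.ne M))
  have hε : 0 < imagTimeWeight β M := by unfold imagTimeWeight; positivity
  set ε : ℝ := imagTimeWeight β M with hεdef
  set Θ : Fin (m + 1) → SpaceTimeIdx L M → SpaceTimeIdx L M → ℂ := fun i xi yi =>
    (sectorAnalysisMatrix L M β F' * sectorSubMatrix L M β (trivialMultiplier L M)) (xi, Ω' i) (yi, (((0 : Fin 1), (Ω' i).1.2), (Ω' i).2)) with hΘ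
  set W : (Fin (m + 1) → Fin N) → (Fin (m + 1) → SpaceTimeIdx L M) → ℂ := fun σ y =>
    sectorisedKernel L M β F G (m + 1) (fun i => ((σ i, (Ω' i).1.2), (Ω' i).2)) y with hW
  -- pointwise: the fine kernel is the sum over parents of the transferred coarse kernels
  have hpt : ∀ x : Fin (m + 1) → SpaceTimeIdx L M, ‖sectorisedKernel L M β F' G (m + 1) Ω' x‖ ≤
      ∑ σ ∈ Par, ε ^ (m + 1) * ∑ y : Fin (m + 1) → SpaceTimeIdx L M, (∏ i, ‖Θ i (x i) (y i)‖) * ‖W σ y‖ := by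
    intro x
    rw [sectorisedKernel_eq_sum_coarse β F' F G Ω' hpl x]
    have hvan : ∀ σ ∈ (univ : Finset (Fin (m + 1) → Fin N)), σ ∉ Par →
        (∑ k : Fin (m + 1) → FreqMomentum L M,
          (∏ i, F' (Ω' i).1.1 (k i) * F (σ i) (k i) * hubbardPlaneWave L M β (Ω' i).2 (k i) (x i)) *
            kernel ℂ G (m + 1) (fun i => ((k i, (Ω' i).1.2), (Ω' i).2))) = 0 :=
      fun σ _ hσ => coarseTerm_eq_zero_of_leg β F' F G Ω' σ (hPar σ hσ) x
    rw [← Finset.sum_subset (subset_univ Par) hvan]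
    refine (norm_sum_le _ _).trans (sum_le_sum fun σ _ => ?_)
    rw [coarseTerm_eq_transfer_sum hβ.ne' F' F G Ω' σ x, norm_mul, norm_pow, Complex.norm_real, Real.norm_of_nonneg hε.le]
    refine mul_le_mul_of_nonneg_left ((norm_sum_le _ _).trans (sum_le_sum fun y _ => ?_)) (pow_nonneg hε.le _)
    rw [norm_mul, norm_prod]
  -- sum over the free positions with leg 0 pinned
  unfold fixedTupleL1
  have hstep1 : ε ^ m * ∑ x' : Fin m → SpaceTimeIdx L M, ‖sectorisedKernel L M β F' G (m + 1) Ω' (Matrix.vecCons x₁ x')‖ ≤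
      ε ^ m * ∑ x' : Fin m → SpaceTimeIdx L M, ∑ σ ∈ Par, ε ^ (m + 1) *
        ∑ y : Fin (m + 1) → SpaceTimeIdx L M, (∏ i, ‖Θ i (Matrix.vecCons x₁ x' i) (y i)‖) * ‖W σ y‖ :=
    mul_le_mul_of_nonneg_left (sum_le_sum fun x' _ => hpt _) (pow_nonneg hε.le m)
  refine hstep1.trans ?_
  rw [sum_comm]
  -- for each parent: the free-position sum of the transfer factors, then the pinned sizes
  have hσ : ∀ σ ∈ Par, ∑ x' : Fin m → SpaceTimeIdx L M, ε ^ (m + 1) *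
      ∑ y : Fin (m + 1) → SpaceTimeIdx L M, (∏ i, ‖Θ i (Matrix.vecCons x₁ x' i) (y i)‖) * ‖W σ y‖ ≤ ε * Cτ ^ m * (Cτ / ε) * (S / ε ^ m) := by
    intro σ hσP
    rw [← mul_sum, sum_comm]
    -- the `x′`-sum of the transfer factors
    have h1 : ∑ y : Fin (m + 1) → SpaceTimeIdx L M, ∑ x' : Fin m → SpaceTimeIdx L M, (∏ i, ‖Θ i (Matrix.vecCons x₁ x' i) (y i)‖) * ‖W σ y‖ ≤
        ∑ y : Fin (m + 1) → SpaceTimeIdx L M, ‖Θ 0 x₁ (y 0)‖ * (Cτ / ε) ^ m * ‖W σ y‖ := by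
      refine sum_le_sum fun y _ => ?_
      rw [← sum_mul]
      exact mul_le_mul_of_nonneg_right (sum_prod_norm_vecCons_le Θ (fun j yy => hcol j.succ yy) x₁ y) (norm_nonneg _)
    -- split `y = y₀ :: y′` and use the pinned sizes of the parent
    have h2 : ∑ y : Fin (m + 1) → SpaceTimeIdx L M, ‖Θ 0 x₁ (y 0)‖ * (Cτ / ε) ^ m * ‖W σ y‖ =
        (Cτ / ε) ^ m * ∑ y₀ : SpaceTimeIdx L M, ‖Θ 0 x₁ y₀‖ * ∑ y' : Fin m → SpaceTimeIdx L M, ‖W σ (Matrix.vecCons y₀ y')‖ := by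
      rw [← (Fin.consEquiv fun _ : Fin (m + 1) => SpaceTimeIdx L M).sum_comp, Fintype.sum_prod_type, mul_sum]
      refine sum_congr rfl fun y₀ _ => ?_
      rw [mul_sum, mul_sum]
      refine sum_congr rfl fun y' _ => ?_
      have hc : ((Fin.consEquiv fun _ : Fin (m + 1) => SpaceTimeIdx L M) (y₀, y')) = Matrix.vecCons y₀ y' := rfl
      rw [hc, Matrix.cons_val_zero]; ring
    have h3 : ∀ y₀ : SpaceTimeIdx L M, ∑ y' : Fin m → SpaceTimeIdx L M, ‖W σ (Matrix.vecCons y₀ y')‖ ≤ S / ε ^ m := by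
      intro y₀
      rw [le_div_iff₀ (pow_pos hε m), mul_comm]
      exact hS σ hσP y₀
    have h4 : ∑ y₀ : SpaceTimeIdx L M, ‖Θ 0 x₁ y₀‖ * ∑ y' : Fin m → SpaceTimeIdx L M, ‖W σ (Matrix.vecCons y₀ y')‖ ≤ (Cτ / ε) * (S / ε ^ m) := by
      calc ∑ y₀ : SpaceTimeIdx L M, ‖Θ 0 x₁ y₀‖ * ∑ y' : Fin m → SpaceTimeIdx L M, ‖W σ (Matrix.vecCons y₀ y')‖
          ≤ ∑ y₀ : SpaceTimeIdx L M, ‖Θ 0 x₁ y₀‖ * (S / ε ^ m) := sum_le_sum fun y₀ _ => mul_le_mul_of_nonneg_left (h3 y₀) (norm_nonneg _)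
        _ = (∑ y₀ : SpaceTimeIdx L M, ‖Θ 0 x₁ y₀‖) * (S / ε ^ m) := by rw [sum_mul]
        _ ≤ (Cτ / ε) * (S / ε ^ m) := mul_le_mul_of_nonneg_right (hrow x₁) (div_nonneg hS0 (pow_nonneg hε.le m))
    calc ε ^ (m + 1) * ∑ y : Fin (m + 1) → SpaceTimeIdx L M, ∑ x' : Fin m → SpaceTimeIdx L M, (∏ i, ‖Θ i (Matrix.vecCons x₁ x' i) (y i)‖) * ‖W σ y‖
        ≤ ε ^ (m + 1) * ((Cτ / ε) ^ m * ((Cτ / ε) * (S / ε ^ m))) := by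
          refine mul_le_mul_of_nonneg_left (h1.trans ?_) (pow_nonneg hε.le _)
          rw [h2]
          exact mul_le_mul_of_nonneg_left h4 (pow_nonneg (div_nonneg hC0 hε.le) m)
      _ = ε * Cτ ^ m * (Cτ / ε) * (S / ε ^ m) := by
          have hε' : ε ≠ 0 := hε.ne'
          rw [div_pow, pow_succ]
          field_simp
  calc ε ^ m * ∑ σ ∈ Par, ∑ x' : Fin m → SpaceTimeIdx L M, ε ^ (m + 1) *
        ∑ y : Fin (m + 1) → SpaceTimeIdx L M, (∏ i, ‖Θ i (Matrix.vecCons x₁ x' i) (y i)‖) * ‖W σ y‖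
      ≤ ε ^ m * ∑ _σ ∈ Par, ε * Cτ ^ m * (Cτ / ε) * (S / ε ^ m) := mul_le_mul_of_nonneg_left (sum_le_sum hσ) (pow_nonneg hε.le m)
    _ = Par.card * Cτ ^ (m + 1) * S := by
        rw [sum_const, nsmul_eq_mul, pow_succ]
        field_simp

end Generic

end Summit.HubbardSuperconductivity.HubbardSuperconductivity.Theorems.EngineV8

end
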